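import Literature.Probability.Percolation.TwoSetConditionalAssociationRC
import Literature.Probability.Percolation.PercolationEvents
import Mathlib.Tactic.Linarith
import HarnessLib

/-!
# One-cluster decoupling for `φ_{𝐩,q}`, `q ≥ 1`: given the apex cluster and non-connection, an increasing event of another cluster is dominated by its free probability

Support file for `stmt-CriticalPhenomena-4575` (memo `prim-gen-kcluster/KCLUSTER-gen67.md` §0.6 / §8; prover prim-gen-kcluster gen 67).
No named facts, no sorries, no new definitions.  It packages the mechanism behind the cross-Harris theorem of
`…LowerTailCrossHarrisTerminalRC.lean` (`CrossHarrisRC.unwire`) in its natural generality: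

**Theorem (`ClusterDecouplingRC.decouple`).**  `V` finite, `q ≥ 1`, vertices `a, u`, parameter vectors `w₁ ≤ w₂` on every
pair NOT containing `a` (the pairs at `a` arbitrary), `𝒰` ANY family of vertex sets (an arbitrary event `{C_a ∈ 𝒰}` of the open
cluster of `a` — not necessarily monotone), `𝒱` an up-set of vertex sets.  Then
`φ_{w₁}(C_a ∈ 𝒰, a ↮ u, C_u ∈ 𝒱) ≤ φ_{w₁}(C_a ∈ 𝒰, a ↮ u) · φ_{w₂}(C_u ∈ 𝒱)`.
In words: conditionally on the whole cluster of `a` and on its not containing `u`, the cluster of `u` is stochastically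
smaller than under ANY free measure with parameters at least `w₁` off the star of `a`.  Proof: vdBHK 2006 Lemma 2.3/2.4 for
`φ_{𝐩,q}` (tree `BHK2006.rc_set_sum_cond_cluster`, S = {a}, T = {u}) + comparison in `𝐩` (tree `sum_rcMass_mono_weights`),
the deleted pairs `W̄ ⊇ star(a)` having parameters `≤ w₂`.
Instances: `𝒰 = ⊤` is the un-wiring lemma (with the roles of the two vertices exchanged); `𝒰 = {S : m ∈ S, x ∉ S}`,
`𝒱 = {S ∋ x}` is the bracket `φ(only m ∈ C_a, u ↔ x) ≤ φ(only m ∈ C_a)·φ(u ↔ x)` used for WSEP(2,2)'s coefficient form A₁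
(memo §0.6).  For `q = 1` and increasing `𝒰` this is weaker than vdBHK Thm 1.4; the point is that `𝒰` is arbitrary and the
second factor is a DIFFERENT measure. [this work]
[cite: VandenbergHaggstromKahn2005, §2.1 Lemmas 2.3–2.4 (p. 10); Thm. 1.4 (p. 7)] [cite: Grimmett2006, Thm. (3.21) (p. 43)]
-/

noncomputable section

namespace Summit.CriticalPhenomena.PercolationContinuityZ3.Theorems

namespace ClusterDecouplingRC

open MeasureTheory Literature.Probability.Percolation Literature.Probability.LatticeModels
open Literature.Probability.Percolation.BHK2006
open Literature.Probability.Percolation.DecisionTree (ind ind_of_mem ind_of_not_mem ind_nonneg)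
open scoped Classical

variable {V : Type*} [Fintype V]

/-- **One-cluster decoupling.**  `q ≥ 1`; `w₁ ≤ w₂` on the pairs not containing `a`; `𝒰` arbitrary, `𝒱` an up-set.  Then
`φ_{w₁}(C_a ∈ 𝒰, a ↮ u, C_u ∈ 𝒱) ≤ φ_{w₁}(C_a ∈ 𝒰, a ↮ u) · φ_{w₂}(C_u ∈ 𝒱)`. [this work] -/
theorem decouple {q : ℝ} (hq : 1 ≤ q) {w₁ w₂ : Sym2 V → unitInterval} {a : V}
    (h : ∀ e : Sym2 V, a ∉ e → w₁ e ≤ w₂ e) (u : V) (𝒰 : Set (Set V)) {𝒱 : Set (Set V)} (h𝒱 : IsUpperSet 𝒱) :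
    (rcMeasureW w₁ q ∅).real ({ω : BondConfig V | openCluster ω a ∈ 𝒰} ∩ (openConn a u : Set (BondConfig V))ᶜ ∩
        {ω : BondConfig V | openCluster ω u ∈ 𝒱}) ≤
      (rcMeasureW w₁ q ∅).real ({ω : BondConfig V | openCluster ω a ∈ 𝒰} ∩ (openConn a u : Set (BondConfig V))ᶜ) *
        (rcMeasureW w₂ q ∅).real {ω : BondConfig V | openCluster ω u ∈ 𝒱} := by
  have hq0 : 0 < q := one_pos.trans_le hq
  -- clusters read off the open edge clusters of singletons
  have hcl : ∀ (η : BondConfig V) (v : V),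
      openCluster η v = {y | y ∈ ({v} : Set V) ∨ ∃ e ∈ setCl η {v}, y ∈ e} := by
    intro η v
    ext y
    show (openGraph η).Reachable v y ↔ (y ∈ ({v} : Set V) ∨ ∃ e ∈ setCl η {v}, y ∈ e)
    rw [← setReach_iff]
    simp only [Set.mem_singleton_iff, exists_eq_left]
  set U : Set (BondConfig V) := {ω : BondConfig V | openCluster ω a ∈ 𝒰} with hUdef
  set W₁ : Set (BondConfig V) := {ω : BondConfig V | openCluster ω u ∈ 𝒱} with hW₁def
  set D : Set (BondConfig V) := (openConn a u : Set (BondConfig V))ᶜ with hDdef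
  have hD : ∀ ω, ω ∈ D ↔ ∀ s ∈ ({a} : Set V), ∀ t ∈ ({u} : Set V), ¬ (openGraph ω).Reachable s t := by
    intro ω
    simp only [hDdef, Set.mem_compl_iff, openConn, Set.mem_setOf_eq, Set.mem_singleton_iff, forall_eq]
  set f : Set (Sym2 V) → ℝ := fun W =>
    if ({y | y ∈ ({a} : Set V) ∨ ∃ e ∈ W, y ∈ e} ∈ 𝒰) then 1 else 0 with hfdef
  set g : Set (Sym2 V) → ℝ := fun W' =>
    if ({y | y ∈ ({u} : Set V) ∨ ∃ e ∈ W', y ∈ e} ∈ 𝒱) then 1 else 0 with hgdef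
  set H : Set (Sym2 V) → Set (Sym2 V) → ℝ := fun W W' => f W * g W' with hHdef
  have hf : ∀ η : BondConfig V, f (setCl η {a}) = ind U η := by
    intro η
    have e1 : η ∈ U ↔ {y | y ∈ ({a} : Set V) ∨ ∃ e ∈ setCl η {a}, y ∈ e} ∈ 𝒰 := by
      rw [← hcl η a]; exact Iff.rfl
    by_cases hη : η ∈ U
    · rw [ind_of_mem hη]; exact if_pos (e1.1 hη)
    · rw [ind_of_not_mem hη]; exact if_neg fun h' => hη (e1.2 h')
  have hg : ∀ η : BondConfig V, g (setCl η {u}) = ind W₁ η := by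
    intro η
    have e1 : η ∈ W₁ ↔ {y | y ∈ ({u} : Set V) ∨ ∃ e ∈ setCl η {u}, y ∈ e} ∈ 𝒱 := by
      rw [← hcl η u]; exact Iff.rfl
    by_cases hη : η ∈ W₁
    · rw [ind_of_mem hη]; exact if_pos (e1.1 hη)
    · rw [ind_of_not_mem hη]; exact if_neg fun h' => hη (e1.2 h')
  have hf0 : ∀ W : Set (Sym2 V), 0 ≤ f W := fun W => by
    simp only [hfdef]; split_ifs <;> norm_num
  -- vdBHK Lemma 2.3/2.4: condition on the cluster of `a`
  have key := rc_set_sum_cond_cluster w₁ hq0 {a} {u} H hD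
  -- monotonicity of the `u`-side
  have hmono : Monotone (ind W₁) := by
    intro ω ω' hle
    have hup : IsUpperSet W₁ := fun _ _ hle' hω =>
      h𝒱 (fun _ hy => SimpleGraph.Reachable.mono (SimpleGraph.fromEdgeSet_mono hle') hy) hω
    by_cases hω : ω ∈ W₁
    · rw [ind_of_mem hω, ind_of_mem (hup hle hω)]
    · rw [ind_of_not_mem hω]; exact ind_nonneg W₁ ω'
  -- the deleted pairs contain the star of `a`, so the conditional parameters are ≤ w₂
  have hdel : ∀ (W : Set (Sym2 V)) (e : Sym2 V), delW w₁ (barOf {a} W) e ≤ w₂ e := by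
    intro W e
    unfold delW
    split_ifs with he
    · exact unitInterval.nonneg'
    · exact h e fun ha => he (mem_barOf_of_mem (Set.mem_singleton a) ha W)
  set γ₂ : ℝ := (rcMeasureW w₂ q ∅).real W₁ with hγ₂
  have hγ₂sum : γ₂ = ∑ η, rcMass w₂ q η * ind W₁ η := rcMeasureW_real_eq_sum_rcMass w₂ hq0 W₁
  have hγ₂0 : 0 ≤ γ₂ := measureReal_nonneg
  have hinner : ∀ ω : BondConfig V,
      ∑ η, rcMass (delW w₁ (barOf {a} (setCl ω {a}))) q η * H (setCl ω {a}) (setCl η {u}) ≤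
        f (setCl ω {a}) * γ₂ := by
    intro ω
    have e1 : ∀ η, rcMass (delW w₁ (barOf {a} (setCl ω {a}))) q η * H (setCl ω {a}) (setCl η {u}) =
        f (setCl ω {a}) * (rcMass (delW w₁ (barOf {a} (setCl ω {a}))) q η * ind W₁ η) := by
      intro η; simp only [hHdef, hg]; ring
    simp only [e1]
    rw [← Finset.mul_sum, hγ₂sum]
    exact mul_le_mul_of_nonneg_left (sum_rcMass_mono_weights (hdel (setCl ω {a})) hq hmono) (hf0 _)
  -- both sides as sums
  have hL : (rcMeasureW w₁ q ∅).real (U ∩ D ∩ W₁) =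
      ∑ ω, rcMass w₁ q ω * (H (setCl ω {a}) (setCl ω {u}) * ind D ω) := by
    rw [rcMeasureW_real_eq_sum_rcMass w₁ hq0]
    refine Finset.sum_congr rfl fun ω _ => ?_
    simp only [hHdef, hf, hg, ind_inter]; ring
  have hR : (rcMeasureW w₁ q ∅).real (U ∩ D) = ∑ ω, rcMass w₁ q ω * (f (setCl ω {a}) * ind D ω) := by
    rw [rcMeasureW_real_eq_sum_rcMass w₁ hq0]
    refine Finset.sum_congr rfl fun ω _ => ?_
    rw [hf, ind_inter]
  rw [hL, key, hR, Finset.sum_mul]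
  refine Finset.sum_le_sum fun ω _ => ?_
  have hm : 0 ≤ rcMass w₁ q ω := rcMass_nonneg w₁ hq0 ω
  have hi : 0 ≤ ind D ω := ind_nonneg D ω
  calc rcMass w₁ q ω * ((∑ η, rcMass (delW w₁ (barOf {a} (setCl ω {a}))) q η *
          H (setCl ω {a}) (setCl η {u})) * ind D ω)
      ≤ rcMass w₁ q ω * ((f (setCl ω {a}) * γ₂) * ind D ω) :=
        mul_le_mul_of_nonneg_left (mul_le_mul_of_nonneg_right (hinner ω) hi) hm
    _ = rcMass w₁ q ω * (f (setCl ω {a}) * ind D ω) * γ₂ := by ring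

/-- **The bracket used for WSEP(2,2)'s coefficient form** (memo §0.6): with `m, x` further vertices,
`φ_{w₁}(m ∈ C_a, x ∉ C_a, a ↮ u, u ↔ x) ≤ φ_{w₁}(m ∈ C_a, x ∉ C_a, a ↮ u) · φ_{w₂}(u ↔ x)` — `q ≥ 1`, `w₁ ≤ w₂` off the star
of `a`. [this work] -/
theorem decouple_onlyIn {q : ℝ} (hq : 1 ≤ q) {w₁ w₂ : Sym2 V → unitInterval} {a : V}
    (h : ∀ e : Sym2 V, a ∉ e → w₁ e ≤ w₂ e) (u m x : V) :
    (rcMeasureW w₁ q ∅).real ({ω : BondConfig V | openCluster ω a ∈ {S : Set V | m ∈ S ∧ x ∉ S}} ∩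
        (openConn a u : Set (BondConfig V))ᶜ ∩ {ω : BondConfig V | openCluster ω u ∈ {S : Set V | x ∈ S}}) ≤
      (rcMeasureW w₁ q ∅).real ({ω : BondConfig V | openCluster ω a ∈ {S : Set V | m ∈ S ∧ x ∉ S}} ∩
          (openConn a u : Set (BondConfig V))ᶜ) *
        (rcMeasureW w₂ q ∅).real {ω : BondConfig V | openCluster ω u ∈ {S : Set V | x ∈ S}} :=
  decouple hq h u _ (fun _ _ hST hS => hST hS)

end ClusterDecouplingRC

end Summit.CriticalPhenomena.PercolationContinuityZ3.Theorems
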